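import Literature.Probability.Percolation.KozmaNitzanClusterProperty
import HarnessLib

/-!
# `NoHeavyLowerTail` (stmt-CriticalPhenomena-4575) — the localized lightness order of the champion

Helper for the floor-split cumulative isolation lemma FSCIL (typed target
`Theorems.noHeavyLowerTail_of_floorSplitCIL`, lemma factory `prim-lf-5`, memo
`run/shared/lean/prim/prim-lf-5/FSCIL-ONELAYER-gen8.md` §§7–8).  `--supports stmt-CriticalPhenomena-4575`.
No definitions, no named facts, no sorries.

Notation: `μ = prodBernoulli w` on a finite vertex type, relays `A`, `N_v = |{x ∈ A : v ↔ x}|` the relay count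
of the cluster of `v`, level `j`; a relay `v` is *light* (at level `j`) if `N_v ≤ j` and *heavy* otherwise.

For one-layer observers the gen-8 analysis of FSCIL (exact rational LPs over all partition laws of `A`,
`|A| ≤ 7`) shows that the inequality is NOT a consequence of Kozma–Nitzan's Lemma 5 and the lightness order
alone (a Harris-violating pseudo-law passes every such row), but IS certified, in every case computed, by a
nonnegative combination of the following "localized lightness order" inequalities of the witness relay `c`
(the H-lightest relay) together with a pointwise-nonnegative remainder:

  if `μ(N_a ≤ j) ≤ μ(N_c ≤ j)` then for every vertex set `S`,
  `μ(N_c > j, c ↮ S) ≤ μ(N_a > j, c ↮ S)`,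

equivalently (subtracting the common event `{N_c > j, N_a > j, c ↮ S}`) the TRANSFER form

  `μ(N_c > j, N_a ≤ j, c ↮ S) ≤ μ(N_c ≤ j, N_a > j, c ↮ S)`.

This is Kozma–Nitzan's Lemma 3(ii) (arXiv:2401.12397, pp. 6–7, with §5.1 p. 31) for the monotone cluster
property `P(C) = (j + 1 ≤ |C ∩ A|)` and the decreasing event `Q = {c ↮ S}` of the cluster of `c`, i.e.
the tree's `KozmaNitzan2024_lemma3_ii_cluster_notConn` read in relay-count language; the case `S = ∅` is the
plain lightness order.  These two statements (`localizedLightnessOrder`, `localizedLightnessTransfer`) are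
the only percolation-specific inputs of the one-layer FSCIL certificate (memo §8, reduction (U)); everything
else there is bookkeeping on deterministic partitions.
-/

noncomputable section

namespace Summit.CriticalPhenomena.PercolationContinuityZ3.Theorems

open MeasureTheory Set Literature.Probability.LatticeModels Literature.Probability.Percolation
open scoped Classical

variable {V : Type*} [Fintype V]

omit [Fintype V] in
/-- The relay count `|C(v) ∩ A|` is a monotone function of the vertex cluster: the predicate
`T ↦ j < |{x ∈ A : x ∈ T}|` is upward closed. [folklore] -/
theorem LocalizedLightness.monotone_relayCount_gt (A : Finset V) (j : ℕ) :
    ∀ S T : Set V, S ⊆ T → j < (A.filter fun x => x ∈ S).card → j < (A.filter fun x => x ∈ T).card := by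
  intro S T hST hS
  refine lt_of_lt_of_le hS (Finset.card_le_card ?_)
  intro x hx
  rw [Finset.mem_filter] at hx ⊢
  exact ⟨hx.1, hST hx.2⟩

omit [Fintype V] in
/-- The event "`v` is heavy", `{j < N_v}`, is the event that the vertex cluster of `v` has the monotone
property `j < |· ∩ A|`. [folklore] -/
theorem LocalizedLightness.setOf_heavy_eq (A : Finset V) (v : V) (j : ℕ) :
    {ω : BondConfig V | j < (A.filter fun x => ω ∈ openConn v x).card} =
      {ω | j < (A.filter fun x => x ∈ openCluster ω v).card} := by
  ext ω
  simp only [mem_setOf_eq]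
  have : (A.filter fun x => ω ∈ openConn v x) = (A.filter fun x => x ∈ openCluster ω v) := by
    refine Finset.filter_congr fun x _ => ?_
    rfl
  rw [this]

omit [Fintype V] in
/-- The event "`v` is light", `{N_v ≤ j}`, is the complement of "`v` is heavy". [folklore] -/
theorem LocalizedLightness.setOf_light_eq_compl (A : Finset V) (v : V) (j : ℕ) :
    {ω : BondConfig V | (A.filter fun x => ω ∈ openConn v x).card ≤ j} =
      {ω : BondConfig V | j < (A.filter fun x => ω ∈ openConn v x).card}ᶜ := by
  ext ω
  simp only [mem_setOf_eq, mem_compl_iff, not_lt]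

/-- **Localized lightness order of the champion** (Kozma–Nitzan's Lemma 3(ii) for the relay count).
If the relay `c` is at least as light as the relay `a` at level `j`, `μ(N_a ≤ j) ≤ μ(N_c ≤ j)`, then for
every vertex set `S`, on the decreasing event `{c ↮ S}` of the cluster of `c` the relay `c` is still no more
often heavy than `a`:  `μ(N_c > j, c ↮ S) ≤ μ(N_a > j, c ↮ S)`.  Proof: pass to complements to get
`μ(N_c > j) ≤ μ(N_a > j)` and apply `KozmaNitzan2024_lemma3_ii_cluster_notConn` with the monotone cluster
property `j < |C ∩ A|`. [cite: KozmaNitzan2024, Lemma 3(ii) (pp. 6–7) and §5.1 (p. 31)] -/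
theorem localizedLightnessOrder (w : Sym2 V → unitInterval) (A : Finset V) (c a : V) (S : Set V) (j : ℕ)
    (hle : (prodBernoulli w).real {ω : BondConfig V | (A.filter fun x => ω ∈ openConn a x).card ≤ j} ≤
      (prodBernoulli w).real {ω : BondConfig V | (A.filter fun x => ω ∈ openConn c x).card ≤ j}) :
    (prodBernoulli w).real ({ω : BondConfig V | j < (A.filter fun x => ω ∈ openConn c x).card} ∩
        {ω | ∀ u ∈ S, ¬ (openGraph ω).Reachable c u}) ≤
      (prodBernoulli w).real ({ω : BondConfig V | j < (A.filter fun x => ω ∈ openConn a x).card} ∩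
        {ω | ∀ u ∈ S, ¬ (openGraph ω).Reachable c u}) := by
  set μ := prodBernoulli w with hμ
  -- complements: `μ(N_c > j) ≤ μ(N_a > j)`
  have hc : μ.real {ω : BondConfig V | j < (A.filter fun x => ω ∈ openConn c x).card} =
      1 - μ.real {ω : BondConfig V | (A.filter fun x => ω ∈ openConn c x).card ≤ j} := by
    rw [LocalizedLightness.setOf_light_eq_compl, measureReal_compl (μ := μ) MeasurableSet.of_discrete,
      probReal_univ]
    ring
  have ha : μ.real {ω : BondConfig V | j < (A.filter fun x => ω ∈ openConn a x).card} =
      1 - μ.real {ω : BondConfig V | (A.filter fun x => ω ∈ openConn a x).card ≤ j} := by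
    rw [LocalizedLightness.setOf_light_eq_compl, measureReal_compl (μ := μ) MeasurableSet.of_discrete,
      probReal_univ]
    ring
  have hheavy : μ.real {ω : BondConfig V | j < (A.filter fun x => x ∈ openCluster ω c).card} ≤
      μ.real {ω : BondConfig V | j < (A.filter fun x => x ∈ openCluster ω a).card} := by
    rw [← LocalizedLightness.setOf_heavy_eq, ← LocalizedLightness.setOf_heavy_eq, hc, ha]
    linarith
  have key := KozmaNitzan2024_lemma3_ii_cluster_notConn w c a
    (fun T : Set V => j < (A.filter fun x => x ∈ T).card)
    (LocalizedLightness.monotone_relayCount_gt A j) S hheavy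
  rw [← LocalizedLightness.setOf_heavy_eq, ← LocalizedLightness.setOf_heavy_eq] at key
  exact key

/-- **Transfer form of the localized lightness order.**  Under the same hypothesis
`μ(N_a ≤ j) ≤ μ(N_c ≤ j)`, for every vertex set `S`:
`μ(N_c > j, N_a ≤ j, c ↮ S) ≤ μ(N_c ≤ j, N_a > j, c ↮ S)` — the mass of "`c` heavy, `a` light, `c`
detached from `S`" is dominated by that of "`c` light, `a` heavy, `c` detached from `S`".  (Subtract the
common event `{N_c > j, N_a > j, c ↮ S}` from both sides of `localizedLightnessOrder`.)  These are the
transfer rows of the one-layer FSCIL certificate. [cite: KozmaNitzan2024, Lemma 3(ii) (pp. 6–7) and §5.1 (p. 31)] -/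
theorem localizedLightnessTransfer (w : Sym2 V → unitInterval) (A : Finset V) (c a : V) (S : Set V)
    (j : ℕ)
    (hle : (prodBernoulli w).real {ω : BondConfig V | (A.filter fun x => ω ∈ openConn a x).card ≤ j} ≤
      (prodBernoulli w).real {ω : BondConfig V | (A.filter fun x => ω ∈ openConn c x).card ≤ j}) :
    (prodBernoulli w).real ({ω : BondConfig V | j < (A.filter fun x => ω ∈ openConn c x).card} ∩
        {ω | (A.filter fun x => ω ∈ openConn a x).card ≤ j} ∩
        {ω | ∀ u ∈ S, ¬ (openGraph ω).Reachable c u}) ≤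
      (prodBernoulli w).real ({ω : BondConfig V | (A.filter fun x => ω ∈ openConn c x).card ≤ j} ∩
        {ω | j < (A.filter fun x => ω ∈ openConn a x).card} ∩
        {ω | ∀ u ∈ S, ¬ (openGraph ω).Reachable c u}) := by
  set μ := prodBernoulli w with hμ
  set Hc : Set (BondConfig V) := {ω | j < (A.filter fun x => ω ∈ openConn c x).card} with hHc
  set Ha : Set (BondConfig V) := {ω | j < (A.filter fun x => ω ∈ openConn a x).card} with hHa
  set Lc : Set (BondConfig V) := {ω | (A.filter fun x => ω ∈ openConn c x).card ≤ j} with hLc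
  set La : Set (BondConfig V) := {ω | (A.filter fun x => ω ∈ openConn a x).card ≤ j} with hLa
  set D : Set (BondConfig V) := {ω | ∀ u ∈ S, ¬ (openGraph ω).Reachable c u} with hD
  have hord : μ.real (Hc ∩ D) ≤ μ.real (Ha ∩ D) := localizedLightnessOrder w A c a S j hle
  -- `Lx = Hxᶜ`
  have hLc' : Lc = Hcᶜ := LocalizedLightness.setOf_light_eq_compl A c j
  have hLa' : La = Haᶜ := LocalizedLightness.setOf_light_eq_compl A a j
  -- split `Hc ∩ D` and `Ha ∩ D` along `Ha`, resp. `Hc`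
  have e1 : μ.real (Hc ∩ D) = μ.real (Hc ∩ D ∩ Ha) + μ.real ((Hc ∩ D) \ Ha) :=
    (measureReal_inter_add_sdiff (μ := μ) (s := Hc ∩ D) (t := Ha) MeasurableSet.of_discrete).symm
  have e2 : μ.real (Ha ∩ D) = μ.real (Ha ∩ D ∩ Hc) + μ.real ((Ha ∩ D) \ Hc) :=
    (measureReal_inter_add_sdiff (μ := μ) (s := Ha ∩ D) (t := Hc) MeasurableSet.of_discrete).symm
  have e3 : Hc ∩ D ∩ Ha = Ha ∩ D ∩ Hc := by
    ext ω
    simp only [mem_inter_iff]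
    tauto
  have e4 : Hc ∩ La ∩ D = (Hc ∩ D) \ Ha := by
    rw [hLa']
    ext ω
    simp only [mem_inter_iff, mem_sdiff, mem_compl_iff]
    tauto
  have e5 : Lc ∩ Ha ∩ D = (Ha ∩ D) \ Hc := by
    rw [hLc']
    ext ω
    simp only [mem_inter_iff, mem_sdiff, mem_compl_iff]
    tauto
  rw [e4, e5]
  rw [e1, e2, e3] at hord
  linarith

end Summit.CriticalPhenomena.PercolationContinuityZ3.Theorems
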